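import Summits.BirchSwinnertonDyer.BirchSwinnertonDyer.Theorems.Rank1ResidualJetCarrierNeIndexKernel
import HarnessLib

/-!
# T1 JET (cell `bsd-jet`), bucket A (`q ≠ p`): LEVEL FORMS of the index-finiteness JET door ⟸ named print
# only (sibling of `Rank1ResidualJetCarrierNeIndexKernel`; the register rows quote a Heegner level `N`)

HONEST FRAMING (programme file `BSD-LIT2PART-PROGRAMME-v1.md` §HONESTY, verbatim): «no tranche here
proves BSD; ARM L moves the LITERAL column of an r ≤ 1 census into the kernel-proved-modulo-named-print
column; ARM P changes what «named print» is worth.» THEOREMS ONLY (seat `bsd-jet-pv-2`, session g7;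
`--supports stmt-BirchSwinnertonDyer-14418`, helper); nothing is booked, 0 classes move (road K is
DOCUMENTARY; bookings are referee A's). Nothing about any particular curve is asserted.

WHAT. The register's bucket-A rows (`JET.bsdp_of_jetRowA5_tam_min` ⟶ `JET.bsdp_of_carrierNeCertificate_level_of_five_le`,
`Rank1ResidualJetCarrierNeRows`) state the Heegner datum at a level `N` (`K` Heegner for `N`, `P` a Heegner
point of level `N`, `q ∣ N`) and identify `N = N_E` by Carayol (`hlev`). These are the level forms of
`JET.bsdp_of_carrierNeCertificate_of_swapLiterature_of_index_ne_zero[_of_five_le]` (sibling file: the JET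
class-free consumer on the INDEX-FINITENESS line, `[E(K):ℤP] ≠ 0` displayed, ⟸ {Poitou–Tate for Selmer
structures, F1, Gross 3.7 (2), GZK} — NO reading binder, NO McCallum 5.2 / Cor. 5.6, NO Kolyvagin
theorem), with `hlev` supplied from modularity `hmod : exists_isNewformOf` (Breuil–Conrad–Diamond–Taylor)
by `IsNewformOf.level_eq_conductorNorm_of_exists_isNewformOf'`. Displayed named print: {PT, F1, Gross
3.7 (2), GZK, modularity}. References: [cite: Jetchev2008, Cor. 1.5 (p. 812)] [cite: DiamondShurman2005,
Thm. 8.8.1] [cite: SerreAbelianLadic1968, Ch. IV §3.4 Lemma 3]. Design: no definitions; `K : Type`.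
Axioms: `propext`, `Classical.choice`, `Quot.sound`.
-/

set_option autoImplicit false

noncomputable section

open scoped Classical

open WeierstrassCurve Literature.NumberTheory.EllipticCurves
  Literature.NumberTheory.EllipticCurves.ModularForms
  Literature.NumberTheory.EllipticCurves.Rank1Residual
  Literature.NumberTheory.GaloisCohomology
  Summit.BirchSwinnertonDyer.Rank1Residual Summit.BirchSwinnertonDyer.Rank1Residual.X11b

namespace Summit.BirchSwinnertonDyer.Rank1Residual.JET

/-- **Level form of `bsdp_of_carrierNeCertificate_of_swapLiterature_of_index_ne_zero`**: the row's Heegner datum at any stated level `N` (`K` Heegner for `N`, `P` a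
Heegner point of level `N`, `q ∣ N`); `N = N_E` by Carayol's theorem from modularity
(`exists_isNewformOf`, Breuil–Conrad–Diamond–Taylor; `IsNewformOf.level_eq_conductorNorm_of_exists_isNewformOf'`).
Displayed named print: {PT, F1, Gross 3.7 (2), GZK, modularity}. [cite: Jetchev2008, Cor. 1.5 (p. 812)]
[cite: DiamondShurman2005, Thm. 8.8.1] -/
theorem bsdp_of_carrierNeCertificate_level_of_swapLiterature_of_index_ne_zero
    (hPT : ∀ (K : Type) [Field K] [NumberField K], poitouTate_selmerStructure_duality_conj K)
    (hF1 : Gross1991_heegnerPoint_sub_ratTorsion_mem_E0)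
    (h372 : GrossLMS1991.prop37_2_frobeniusCongruence)
    (hGZK : rank_eq_analyticRank_of_analyticRank_le_one) (hmod : exists_isNewformOf)
    (W : WeierstrassCurve ℚ) [W.IsElliptic] [W.IsGloballyMinimal] (p : ℕ) [Fact p.Prime]
    {N : ℕ} [NeZero N] {K : Type} [Field K] [NumberField K] (hK : IsImaginaryQuadratic K)
    (hD3 : NumberField.discr K ≠ -3) (hD4 : NumberField.discr K ≠ -4)
    (hH : SatisfiesHeegnerHypothesis N K) {P : (W.baseChange K).toAffine.Point}
    (hP : IsHeegnerPoint N W K P) (hnt : ¬ IsOfFinAddOrder P)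
    (hp2 : p ≠ 2) (htower : ∀ n : ℕ, W.HasSurjectiveModNGaloisRep (p ^ n : ℕ))
    (q : ℕ) [Fact q.Prime] (hqN : q ∣ N) (hqp : q ≠ p)
    (hfin : (AddSubgroup.zmultiples P).index ≠ 0)
    (hI : padicValNat p (AddSubgroup.zmultiples P).index ≤
      padicValNat p ((W.baseChange ℚ_[q]).localTamagawaNumber ℤ_[q]))
    (hr : W.analyticRank ≤ 1) {s : ℚ} (hs : shaAn W = (s : ℂ)) (hv : padicValRat p s = 0) :
    BSDp W p := by
  obtain ⟨Dt, -, -, -⟩ := id hP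
  have hN : N = W.conductorNorm ℤ := IsNewformOf.level_eq_conductorNorm_of_exists_isNewformOf' hmod Dt.isNewformOf
  subst hN
  exact bsdp_of_carrierNeCertificate_of_swapLiterature_of_index_ne_zero hPT hF1 h372 hGZK W K hK hD3 hD4 hH
    p hp2 htower hP hnt q hqN hqp hfin hI hr hs hv

/-- **Level form, `p ≥ 5`, from `ρ̄_{E,p}` onto** — the shape of the register's bucket-A road S
(`JET.bsdp_of_jetRowA5_tam_min` ⟶ `…_level_of_five_le`), on the index-finiteness line, from named print
only. [cite: Jetchev2008, Cor. 1.5 (p. 812)] [cite: SerreAbelianLadic1968, Ch. IV §3.4 Lemma 3] -/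
theorem bsdp_of_carrierNeCertificate_level_of_swapLiterature_of_index_ne_zero_of_five_le
    (hPT : ∀ (K : Type) [Field K] [NumberField K], poitouTate_selmerStructure_duality_conj K)
    (hF1 : Gross1991_heegnerPoint_sub_ratTorsion_mem_E0)
    (h372 : GrossLMS1991.prop37_2_frobeniusCongruence)
    (hGZK : rank_eq_analyticRank_of_analyticRank_le_one) (hmod : exists_isNewformOf)
    (W : WeierstrassCurve ℚ) [W.IsElliptic] [W.IsGloballyMinimal] (p : ℕ) [Fact p.Prime]
    {N : ℕ} [NeZero N] {K : Type} [Field K] [NumberField K] (hK : IsImaginaryQuadratic K)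
    (hD3 : NumberField.discr K ≠ -3) (hD4 : NumberField.discr K ≠ -4)
    (hH : SatisfiesHeegnerHypothesis N K) {P : (W.baseChange K).toAffine.Point}
    (hP : IsHeegnerPoint N W K P) (hnt : ¬ IsOfFinAddOrder P)
    (h5 : 5 ≤ p) (hsurj : W.HasSurjectiveModNGaloisRep p)
    (q : ℕ) [Fact q.Prime] (hqN : q ∣ N) (hqp : q ≠ p)
    (hfin : (AddSubgroup.zmultiples P).index ≠ 0)
    (hI : padicValNat p (AddSubgroup.zmultiples P).index ≤
      padicValNat p ((W.baseChange ℚ_[q]).localTamagawaNumber ℤ_[q]))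
    (hr : W.analyticRank ≤ 1) {s : ℚ} (hs : shaAn W = (s : ℂ)) (hv : padicValRat p s = 0) :
    BSDp W p := by
  have hp2 : p ≠ 2 := by omega
  exact bsdp_of_carrierNeCertificate_level_of_swapLiterature_of_index_ne_zero hPT hF1 h372 hGZK hmod W p hK
    hD3 hD4 hH hP hnt hp2 (serre_hasSurjectiveModNGaloisRep_pow_holds W p h5 hsurj) q hqN hqp hfin hI hr
    hs hv

end Summit.BirchSwinnertonDyer.Rank1Residual.JET

end
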